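import Literature.Topology.FourManifolds.GluckTwist
import Literature.Topology.FourManifolds.GluckTwistFacts
import Literature.Topology.FourManifolds.SPC4Wave0
import HarnessLib

/-!
# A Gluck twist is a homotopy 4-sphere: decomposition of `Σ_K ≃ₜ S⁴` (Gluck 1962 §17 + Freedman)

Decomposition (D-0014 provefact, XL) of the named fact
`Literature.Topology.FourManifolds.nonempty_homeomorph_sphere_of_isGluckTwist` (`GluckTwist.lean`): *a Gluck twist `Σ_K` of `S⁴`
along a 2-knot `K` is homeomorphic to `S⁴`*. The printed argument has two layers, recorded here as
named facts with **proved** assembly steps between them: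

1. (Gluck, Trans. AMS 104 (1962), §17; Kirby, *The Topology of 4-Manifolds* (1989), Ch. I §6,
   p. 16: "the result `Q⁴(Θ)` is easily seen to be a homotopy 4-sphere") `Σ_K` is a closed simply
   connected 4-manifold with `H₂(Σ_K; ℤ) = 0` (Seifert–van Kampen and Mayer–Vietoris for
   `Σ_K = (S⁴ ∖ νK) ∪_τ (S² × D²)`: the twist `τ` induces the identity on `H_*(S² × S¹)` and
   preserves meridians), hence (Hurewicz + Whitehead + Poincaré duality,
   `Literature.Topology.FourManifolds.nonempty_homotopyEquiv_sphere_four_iff`) homotopy equivalent to `S⁴`;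
2. (Freedman, J. Diff. Geom. 17 (1982), Thm. 1.6; Freedman–Quinn, *Topology of 4-Manifolds*
   (1990), Cor. 7.1B: "A 4-manifold homotopy equivalent to `S⁴` is homeomorphic to `S⁴`",
   `Literature.Topology.FourManifolds.nonempty_homeomorph_sphere_four`) hence homeomorphic to `S⁴`.

## Contents

* `Literature.Topology.FourManifolds.isZero_singularHomologyZ_two_of_isGluckTwist` (named fact, Gluck 1962 §17): `H₂(Σ_K; ℤ) = 0`.
* `Literature.Topology.FourManifolds.nonempty_homotopyEquiv_sphere_of_isGluckTwist` (named fact, Gluck 1962 §17; Kirby 1989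
  Ch. I §6): `Σ_K ≃ₕ S⁴`.
* `Literature.Topology.FourManifolds.nonempty_homotopyEquiv_sphere_of_isGluckTwist_of` (proved): layer 1 from
  `IsGluckTwist.compactSpace`, `simplyConnectedSpace_of_isGluckTwist`,
  `isZero_singularHomologyZ_two_of_isGluckTwist` and `SPC4.nonempty_homotopyEquiv_sphere_four_iff`.
* `Literature.Topology.FourManifolds.nonempty_homeomorph_sphere_of_isGluckTwist_of` (proved): the target fact from
  `nonempty_homotopyEquiv_sphere_of_isGluckTwist` and Freedman's theorem
  `SPC4.nonempty_homeomorph_sphere_four`.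
* `Literature.Topology.FourManifolds.nonempty_homeomorph_sphere_of_isGluckTwist_of_facts` (proved): both layers at once.
* `Literature.Topology.FourManifolds.gluck_homeomorph_sphere_four_of` (proved): the universe-`0` route fact
  `gluck_homeomorph_sphere_four` (`GluckTwistFacts.lean`) from the target fact.

Remaining leaves of the DAG (all named facts, none proved): `IsGluckTwist.compactSpace`,
`simplyConnectedSpace_of_isGluckTwist`, `isZero_singularHomologyZ_two_of_isGluckTwist` (Gluck §17),
`SPC4.nonempty_homotopyEquiv_sphere_four_iff` (Freedman–Quinn §10), `SPC4.nonempty_homeomorph_sphere_four`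
(Freedman Thm. 1.6). No declaration here uses `sorry`.

## References

* H. Gluck, *The embedding of two-spheres in the four-sphere*, Trans. Amer. Math. Soc. 104 (1962)
  308–333, §17 [GluckTAMS1962].
* R. C. Kirby, *The Topology of 4-Manifolds*, Lecture Notes in Math. 1374 (1989), Ch. I §6, p. 16
  [Kirby1989].
* M. H. Freedman, *The topology of four-dimensional manifolds*, J. Differential Geom. 17 (1982)
  357–453, Thm. 1.6 [FreedmanJDG1982].
* M. H. Freedman, F. Quinn, *Topology of 4-Manifolds*, Princeton Math. Series 39 (1990), §7.1,
  Cor. 7.1B [FreedmanQuinnPMS1990].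

## Design choices

* Statements are universe-polymorphic in the carrier `X : Type u`, exactly like the target fact and
  the `SPC4` facts they are assembled with; `H₂(X; ℤ)` is `Literature.SPC4.singularHomologyZ X 2`
  (Mathlib's `AlgebraicTopology.singularHomologyFunctor`, coefficients `ULift ℤ`), the object used
  by `SPC4.nonempty_homotopyEquiv_sphere_four_iff`, so that the layers compose without glue.
* The hypotheses `IsGluckTwist.compactSpace` and `simplyConnectedSpace_of_isGluckTwist` of
  `GluckTwist.lean` are stated there for an arbitrary model `IX`; the assembly theorem consumes
  their specialisations to `IX = 𝓡 4`, `X : Type u`.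
-/

open scoped Manifold ContDiff Topology
open ContinuousMap CategoryTheory

noncomputable section

namespace Literature.Topology.FourManifolds

universe u

/-- Local notation: `𝔼 n` is the model Euclidean space `EuclideanSpace ℝ (Fin n)`. -/
local notation "𝔼 " n:arg => EuclideanSpace ℝ (Fin n)

/-- Local notation: `𝕊 n` is the unit sphere in `EuclideanSpace ℝ (Fin (n + 1))`. -/
local notation "𝕊 " n:arg => (Metric.sphere (0 : EuclideanSpace ℝ (Fin (n + 1))) 1)

variable {K : TwoKnot}

/-- **Gluck 1962, §17 (homology of the Gluck twist, degree 2).** For every Hausdorff second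
countable smooth 4-manifold `X` which is a Gluck twist of `S⁴` along the 2-knot `K`,
`H₂(X; ℤ) = 0`: by Mayer–Vietoris for `X = (S⁴ ∖ νK) ∪ (S² × D²)` glued along `S² × S¹` by the
Gluck map `τ`, which induces the identity on `H_*(S² × S¹; ℤ)`, `X` has the integral homology of
`S⁴ = (S⁴ ∖ νK) ∪_{id} (S² × D²)` (Gluck, Trans. AMS 104 (1962), §17; Kirby (1989), Ch. I §6,
p. 16). Only the degree-2 vanishing, the input of `SPC4.nonempty_homotopyEquiv_sphere_four_iff`,
is recorded. [cite: GluckTAMS1962, §17] [cite: Kirby1989, Ch. I §6, p. 16] -/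
def isZero_singularHomologyZ_two_of_isGluckTwist : Prop :=
  ∀ {X : Type u} [TopologicalSpace X] [T2Space X] [SecondCountableTopology X]
    [ChartedSpace (𝔼 4) X] [IsManifold (𝓡 4) ∞ X] (_ : IsGluckTwist (𝓡 4) X K),
    Limits.IsZero (FourManifolds.singularHomologyZ X 2)

/-- **Gluck 1962, §17: a Gluck twist is a homotopy 4-sphere.** For every Hausdorff second
countable smooth 4-manifold `X` which is a Gluck twist of `S⁴` along the 2-knot `K`, `X` is
homotopy equivalent to `S⁴` (Gluck, Trans. AMS 104 (1962), §17; Kirby, *The Topology of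
4-Manifolds* (1989), Ch. I §6, p. 16: "The result `Q⁴(Θ)` is easily seen to be a homotopy
4-sphere"). See `nonempty_homotopyEquiv_sphere_of_isGluckTwist_of` for its reduction to
compactness, simple connectivity, `H₂ = 0` and `spc4.S10`.
[cite: GluckTAMS1962, §17] [cite: Kirby1989, Ch. I §6, p. 16] -/
def nonempty_homotopyEquiv_sphere_of_isGluckTwist : Prop :=
  ∀ {X : Type u} [TopologicalSpace X] [T2Space X] [SecondCountableTopology X]
    [ChartedSpace (𝔼 4) X] [IsManifold (𝓡 4) ∞ X] (_ : IsGluckTwist (𝓡 4) X K),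
    Nonempty (X ≃ₕ (𝕊 4))

/-- **Layer 1 (assembly, proved).** A Gluck twist is a homotopy 4-sphere, granted that it is
compact (`IsGluckTwist.compactSpace`), simply connected (`simplyConnectedSpace_of_isGluckTwist`),
has `H₂ = 0` (`isZero_singularHomologyZ_two_of_isGluckTwist`) (all Gluck 1962, §17), and the
characterisation of homotopy 4-spheres among closed topological 4-manifolds by `π₁ = 1`,
`H₂ = 0` (`SPC4.nonempty_homotopyEquiv_sphere_four_iff`, Freedman–Quinn (1990), §10).
[cite: GluckTAMS1962, §17] -/
theorem nonempty_homotopyEquiv_sphere_of_isGluckTwist_of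
    (hc : ∀ {X : Type u} [TopologicalSpace X] [ChartedSpace (𝔼 4) X],
      IsGluckTwist.compactSpace (IX := 𝓡 4) (X := X) (K := K))
    (hπ : ∀ {X : Type u} [TopologicalSpace X] [ChartedSpace (𝔼 4) X],
      simplyConnectedSpace_of_isGluckTwist (IX := 𝓡 4) (X := X) (K := K))
    (hH : isZero_singularHomologyZ_two_of_isGluckTwist.{u} (K := K))
    (hS10 : FourManifolds.nonempty_homotopyEquiv_sphere_four_iff.{u}) :
    nonempty_homotopyEquiv_sphere_of_isGluckTwist.{u} (K := K) := by
  intro X _ _ _ _ _ h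
  haveI : CompactSpace X := hc h
  exact (hS10 X).2 ⟨hπ h, hH h⟩

/-- **Layer 2 (assembly, proved): Gluck 1962 §17 + Freedman 1982 Thm. 1.6.** A Gluck twist is
homeomorphic to `S⁴`, granted that it is a homotopy 4-sphere
(`nonempty_homotopyEquiv_sphere_of_isGluckTwist`, Gluck 1962, §17) and Freedman's topological
4-dimensional Poincaré theorem (`SPC4.nonempty_homeomorph_sphere_four`; Freedman, J. Diff. Geom.
17 (1982), Thm. 1.6; Freedman–Quinn (1990), Cor. 7.1B: "A 4-manifold homotopy equivalent to `S⁴`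
is homeomorphic to `S⁴`"). This is the target fact `nonempty_homeomorph_sphere_of_isGluckTwist`
of `GluckTwist.lean`, reduced to its two printed sources.
[cite: GluckTAMS1962, §17] [cite: FreedmanJDG1982, Thm. 1.6]
[cite: FreedmanQuinnPMS1990, §7.1, Cor. 7.1B] -/
theorem nonempty_homeomorph_sphere_of_isGluckTwist_of
    (h17 : nonempty_homotopyEquiv_sphere_of_isGluckTwist.{u} (K := K))
    (hF : FourManifolds.nonempty_homeomorph_sphere_four.{u}) :
    nonempty_homeomorph_sphere_of_isGluckTwist.{u} (K := K) := by
  intro X _ _ _ _ _ h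
  obtain ⟨e⟩ := h17 h
  exact hF X e

/-- **Both layers at once (proved).** The target fact `nonempty_homeomorph_sphere_of_isGluckTwist`
from the five leaves of the DAG: compactness, simple connectivity and `H₂ = 0` of Gluck twists
(Gluck 1962, §17), the `π₁`/`H₂` characterisation of homotopy 4-spheres (Freedman–Quinn §10) and
Freedman's theorem (Freedman 1982, Thm. 1.6). [cite: GluckTAMS1962, §17]
[cite: FreedmanJDG1982, Thm. 1.6] -/
theorem nonempty_homeomorph_sphere_of_isGluckTwist_of_facts
    (hc : ∀ {X : Type u} [TopologicalSpace X] [ChartedSpace (𝔼 4) X],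
      IsGluckTwist.compactSpace (IX := 𝓡 4) (X := X) (K := K))
    (hπ : ∀ {X : Type u} [TopologicalSpace X] [ChartedSpace (𝔼 4) X],
      simplyConnectedSpace_of_isGluckTwist (IX := 𝓡 4) (X := X) (K := K))
    (hH : isZero_singularHomologyZ_two_of_isGluckTwist.{u} (K := K))
    (hS10 : FourManifolds.nonempty_homotopyEquiv_sphere_four_iff.{u})
    (hF : FourManifolds.nonempty_homeomorph_sphere_four.{u}) :
    nonempty_homeomorph_sphere_of_isGluckTwist.{u} (K := K) :=
  nonempty_homeomorph_sphere_of_isGluckTwist_of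
    (nonempty_homotopyEquiv_sphere_of_isGluckTwist_of hc hπ hH hS10) hF

/-- A homotopy 4-sphere fact implies the `H₂ = 0` fact back, granted compactness and `spc4.S10`
(consistency check of the decomposition: layer 1 loses nothing in degree 2). [folklore] -/
theorem isZero_singularHomologyZ_two_of_isGluckTwist_of
    (hc : ∀ {X : Type u} [TopologicalSpace X] [ChartedSpace (𝔼 4) X],
      IsGluckTwist.compactSpace (IX := 𝓡 4) (X := X) (K := K))
    (h17 : nonempty_homotopyEquiv_sphere_of_isGluckTwist.{u} (K := K))
    (hS10 : FourManifolds.nonempty_homotopyEquiv_sphere_four_iff.{u}) :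
    isZero_singularHomologyZ_two_of_isGluckTwist.{u} (K := K) := by
  intro X _ _ _ _ _ h
  haveI : CompactSpace X := hc h
  exact ((hS10 X).1 (h17 h)).2

/-- The universe-`0` route fact `gluck_homeomorph_sphere_four` (`GluckTwistFacts.lean`, consumed by
route SmoothPoincare4/GluckLasagna) is the target fact `nonempty_homeomorph_sphere_of_isGluckTwist`
at every 2-knot. [folklore] -/
theorem gluck_homeomorph_sphere_four_of
    (h : ∀ K : TwoKnot, nonempty_homeomorph_sphere_of_isGluckTwist.{0} (K := K)) :
    gluck_homeomorph_sphere_four :=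
  fun K _ _ _ _ _ _ hX => h K hX

/-- Conversely the route fact gives the target fact at universe `0`. [folklore] -/
theorem nonempty_homeomorph_sphere_of_isGluckTwist_of_gluck_homeomorph_sphere_four
    (h : gluck_homeomorph_sphere_four) (K : TwoKnot) :
    nonempty_homeomorph_sphere_of_isGluckTwist.{0} (K := K) :=
  fun {X} _ _ _ _ _ hX => h K X hX

/-- The route fact `gluck_homeomorph_sphere_four` from the two printed sources: Gluck twists are
homotopy 4-spheres (Gluck 1962, §17) and Freedman's theorem (1982, Thm. 1.6), both at universe `0`.
[cite: GluckTAMS1962, §17] [cite: FreedmanJDG1982, Thm. 1.6] -/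
theorem gluck_homeomorph_sphere_four_of_facts
    (h17 : ∀ K : TwoKnot, nonempty_homotopyEquiv_sphere_of_isGluckTwist.{0} (K := K))
    (hF : FourManifolds.nonempty_homeomorph_sphere_four.{0}) : gluck_homeomorph_sphere_four :=
  gluck_homeomorph_sphere_four_of fun K => nonempty_homeomorph_sphere_of_isGluckTwist_of (h17 K) hF

end Literature.Topology.FourManifolds

end
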